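import Mathlib
import HarnessLib
import Summits.HubbardSuperconductivity.HubbardSuperconductivity.Theorems.KLProgrammeKLRegimeTwoVolumeLipDiffDefs
import Summits.HubbardSuperconductivity.HubbardSuperconductivity.Theorems.KLProgrammeKLRegimeEngineTowerBlockStepWt
import Summits.HubbardSuperconductivity.HubbardSuperconductivity.Theorems.KLProgrammeKLRegimeEngineTowerBlockIncrWt

/-!
# Route `KLProgramme` — crux K3 ENGINE (stmt-HubbardSuperconductivity-20437), stub (e) proof-input «(e)-D-ROWS», F-D4 first brick: THE ONE-VOLUME BLOCK
# IDENTITY OF THE TWO-VOLUME LIPSCHITZ TOWER in the `(f, g)`-reading, and the LIPSCHITZ / SOURCE split of the born difference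
# (seat hubbard-kl-k3c4-p1 g23; `--supports` 20437; DROWS-SCOPE-g22 §8, §8.1)

The deep block-step door `…TwoVolumeLipDeepFirstOrder.sum_pinned_norm_kernel_map_born_sub_born_le_of_deep` reads the step as
`map g (born_C (map f (V + D)) − born_C (map f V))`, `born_C Y = effAction C Y − Y`.  At block `k ≥ 1` of the blocked flow (`…EngineTowerModelDefs`, boundaries
`J_k = dk`, covariance `Γ_k = C^K_{(Λ_{d(k+1)}, Λ_{dk}]}`) of ONE volume `V` the dictionary is E1's (`…EngineTowerBlockStep{Wt,Lip}`):
`f := toLin' S_V(F̃_{dk−1})` (synthesis with the fat partner of the measuring family), `g := toLin' (ε • E_V(F_{dk}))` (analysis by the born family, fields scaled by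
`ε`), input `D := klLipInput V … d k = sectorPreimage β F_{dk−1} 𝒱_{dk}` (`…TwoVolumeLipTowerDefs`).  With the plateau facts of the engine
(`bgmFatMultiplier_mul_bgmMultiplier`, `klAnisoFamily_eq_zero_of_sum_eq_zero`, `sum_klAnisoFamily_eq_one_of_blockSliceCT_ne_zero`,
`sum_klAnisoFamily_pred_eq_one_of_klAnisoFamily_ne_zero`) and the semigroup (`klTowerIncr_eq_effAction_sub`, `Z^K_{Λ_{dk}} ≠ 0`):

* §1 (sector-field lemmas, any families) `map_sectorAnalysis_map_sectorSub_sectorPreimage_of_plateau` (zeroth order of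
  `Lit/….map_sectorAnalysis_effAction_map_sectorPreimage_of_plateau`: `map E(F′) (map S(F̃) (sectorPreimage F G)) = map E(F′) G`), `sectorPreimage_eq_map_map`
  (`sectorPreimage β F′ Y = map (toLin' (ε•1)) (map E(F′) Y)`), `sectorPreimage_congr_of_map_sectorAnalysis_eq`, `sectorPreimage_sub`;
* §2 **`klLipBorn_eq_sectorPreimage_born`** — `klLipBorn V … d k = sectorPreimage β F_{dk} (born_{Γ_k} (map f (klLipInput V … d k)))`, and its `(f,g)`-form
  **`klLipBorn_eq_map_born`** — `klLipBorn V … d k = map g (born_{Γ_k} (map f (klLipInput V … d k)))`;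
* §3 TWO volumes at the common frame: **`klLipBornDiff_eq_lip_add_src`** — with `V := klGlue (klLipInput L …)`, `V + D = klLipInput (bL) …` (`klLipInput_fine_eq`),
  `klLipBornDiff L b M … d k = [map g (born(f(V+D)) − born(fV))] + [map g (born (f V)) − klGlue (klLipBorn L … d k)]` — the LIPSCHITZ part (the deep block-step door's
  left side, fine volume's `f, g, Γ_k`) plus the SOURCE part (the fine step of the glued coarse input against the glued coarse step: covariance near/far + transfer,
  DROWS-SCOPE-g22 §7.3; bounded in F-D5).

Identities only (no sizes); nothing asserts the (D) rows, stub (e), VL, K3 or superconductivity.  References: BGM 2006 §2.7 (2.70)–(2.71)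
[cite: BenfattoGiulianiMastropietro2006].
-/

noncomputable section

namespace Summit.HubbardSuperconductivity.HubbardSuperconductivity.Theorems.TwoVolumeLip

set_option linter.dupNamespace false -- summit = problem name (single-conjunct summit), D-0017

open Finset Literature.MathematicalPhysics.QuantumLattice GrassmannAlgebra Literature.Probability.LatticeModels
open Literature.MathematicalPhysics.QuantumLattice.FermiRG
open Summit.HubbardSuperconductivity.HubbardSuperconductivity.Theorems.KLRegimeSplit
open Summit.HubbardSuperconductivity.HubbardSuperconductivity.Theorems.KLProgrammeLegKernels
open Summit.HubbardSuperconductivity.HubbardSuperconductivity.Theorems.DispersionFlow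
open Summit.HubbardSuperconductivity.HubbardSuperconductivity.Theorems.EngineV8
open Summit.HubbardSuperconductivity.HubbardSuperconductivity.Theorems.TwoVolumeSource
open Summit.HubbardSuperconductivity.HubbardSuperconductivity.Theorems.TwoVolumeDefect

/-! ## §1 Sector-field lemmas (any families) -/

section SectorField

variable {V M : ℕ} [NeZero V] {N N' : ℕ}

/-- **Zeroth order of the plateau identity**: the analysis by `F′` does not see the plateau rescaling of the synthesised preimage,
`map (toLin' E(F′)) (map (toLin' S(F̃)) (sectorPreimage β F G)) = map (toLin' E(F′)) G`, when `F̃F = F`, `F` vanishes where its sum does, and `F′` lives on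
the plateau `Σ_ω F_ω = 1`. -/
theorem map_sectorAnalysis_map_sectorSub_sectorPreimage_of_plateau [NeZero M] {β : ℝ} (hβ : β ≠ 0) (F Ft : Fin N → FreqMomentum V M → ℂ)
    (hFF : ∀ ω k, Ft ω k * F ω k = F ω k) (hF0 : ∀ k, ∑ ω, F ω k = 0 → ∀ ω, F ω k = 0) (F' : Fin N' → FreqMomentum V M → ℂ)
    (hF'pl : ∀ (ω' : Fin N') (k : FreqMomentum V M), F' ω' k ≠ 0 → ∑ ω, F ω k = 1) (G : HubbardGrassmann V M) :
    ExteriorAlgebra.map (Matrix.toLin' (sectorAnalysisMatrix V M β F'))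
        (ExteriorAlgebra.map (Matrix.toLin' (sectorSubMatrix V M β Ft)) (sectorPreimage β F G)) =
      ExteriorAlgebra.map (Matrix.toLin' (sectorAnalysisMatrix V M β F')) G := by
  rw [map_sectorSub_sectorPreimage_eq_map_mulLeft hβ F Ft hFF hF0 G, map_map_eq_map_comp,
    toLin'_sectorAnalysis_comp_mulLeft β F' _ fun ω' K hK => hF'pl ω' K.1.1 hK]

/-- The sector preimage through the plain analysis: `sectorPreimage β F′ Y = map (toLin' (ε • 1)) (map (toLin' E(F′)) Y)`. -/
theorem sectorPreimage_eq_map_map (β : ℝ) (F' : Fin N' → FreqMomentum V M → ℂ) (Y : HubbardGrassmann V M) :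
    sectorPreimage β F' Y =
      ExteriorAlgebra.map (Matrix.toLin' ((((imagTimeWeight β M : ℝ) : ℂ)) • (1 : Matrix (SpaceTimeIdx V M × SectorLeg N') (SpaceTimeIdx V M × SectorLeg N') ℂ)))
        (ExteriorAlgebra.map (Matrix.toLin' (sectorAnalysisMatrix V M β F')) Y) := by
  rw [sectorPreimage_eq_map_smul_sectorAnalysis, map_map_eq_map_comp, ← Matrix.toLin'_mul, Matrix.smul_mul, Matrix.one_mul]

/-- **The sector preimage only sees the plainly analysed element**: `map E(F′) Y₁ = map E(F′) Y₂ ⇒ sectorPreimage β F′ Y₁ = sectorPreimage β F′ Y₂`. -/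
theorem sectorPreimage_congr_of_map_sectorAnalysis_eq (β : ℝ) (F' : Fin N' → FreqMomentum V M → ℂ) {Y₁ Y₂ : HubbardGrassmann V M}
    (h : ExteriorAlgebra.map (Matrix.toLin' (sectorAnalysisMatrix V M β F')) Y₁ = ExteriorAlgebra.map (Matrix.toLin' (sectorAnalysisMatrix V M β F')) Y₂) :
    sectorPreimage β F' Y₁ = sectorPreimage β F' Y₂ := by
  rw [sectorPreimage_eq_map_map, sectorPreimage_eq_map_map, h]

/-- The sector preimage is additive. -/
theorem sectorPreimage_add (β : ℝ) (F' : Fin N' → FreqMomentum V M → ℂ) (Y₁ Y₂ : HubbardGrassmann V M) :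
    sectorPreimage β F' (Y₁ + Y₂) = sectorPreimage β F' Y₁ + sectorPreimage β F' Y₂ := by
  simp only [sectorPreimage_eq_map_smul_sectorAnalysis, map_add]

/-- The sector preimage of a difference. -/
theorem sectorPreimage_sub (β : ℝ) (F' : Fin N' → FreqMomentum V M → ℂ) (Y₁ Y₂ : HubbardGrassmann V M) :
    sectorPreimage β F' (Y₁ - Y₂) = sectorPreimage β F' Y₁ - sectorPreimage β F' Y₂ := by
  simp only [sectorPreimage_eq_map_smul_sectorAnalysis, map_sub]

end SectorField

/-! ## §2 One volume: the born increment of block `k` is the born step of the synthesised analysed input, read by the born family -/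

section OneVolume

variable {V M : ℕ} [NeZero V] [NeZero M]

/-- **THE ONE-VOLUME BLOCK IDENTITY (sector-preimage form).**  For `β ≠ 0`, `1 ≤ dk`, `Z^K_{Λ_{dk}} ≠ 0`:
`klLipBorn V … d k = sectorPreimage β F_{dk} (effAction Γ_k (map (toLin' S(F̃_{dk−1})) (klLipInput V … d k)) − map (toLin' S(F̃_{dk−1})) (klLipInput V … d k))`,
`Γ_k = C^K_{(Λ_{d(k+1)}, Λ_{dk}]}` — the semigroup plus the plateau facts (the born family `F_{dk}` and the block covariance live on the plateau of `F_{dk−1}`).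
[cite: BenfattoGiulianiMastropietro2006, §2.7 (2.70)-(2.71)] -/
theorem klLipBorn_eq_sectorPreimage_born {β : ℝ} (hβ : β ≠ 0) (U μ : ℝ) (K : TrigPolyC4v) {d k : ℕ} (hdk : 1 ≤ d * k)
    (hZ : hubbardEffPartitionFnCT V M β U μ 0 K (klScale klE0 (d * k)) ≠ 0) :
    klLipBorn V M β U μ K d k =
      sectorPreimage β (klAnisoFamily V M β μ K klE0 (d * k))
        (effAction ℂ (hubbardCovSliceCT V M β μ 0 K (klScale klE0 (d * (k + 1))) (klScale klE0 (d * k)))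
            (ExteriorAlgebra.map (Matrix.toLin' (sectorSubMatrix V M β (bgmFatMultiplier V M klE0 β (nambuXiCT V μ K) (d * k - 1))))
              (klLipInput V M β U μ K d k)) -
          ExteriorAlgebra.map (Matrix.toLin' (sectorSubMatrix V M β (bgmFatMultiplier V M klE0 β (nambuXiCT V μ K) (d * k - 1))))
            (klLipInput V M β U μ K d k)) := by
  have he : (0 : ℝ) < klE0 := by norm_num [klE0]
  have hJ : d * k ≤ d * (k + 1) := Nat.mul_le_mul_left d (Nat.le_succ k)
  -- plateau facts of the engine at `(J₁, J₂, J′) = (dk, d(k+1), dk)`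
  have hFF : ∀ ω p, bgmFatMultiplier V M klE0 β (nambuXiCT V μ K) (d * k - 1) ω p * klAnisoFamily V M β μ K klE0 (d * k - 1) ω p =
      klAnisoFamily V M β μ K klE0 (d * k - 1) ω p :=
    fun ω p => bgmFatMultiplier_mul_bgmMultiplier he β (nambuXiCT V μ K) (d * k - 1) ω p
  have hF0 : ∀ p, ∑ ω, klAnisoFamily V M β μ K klE0 (d * k - 1) ω p = 0 → ∀ ω, klAnisoFamily V M β μ K klE0 (d * k - 1) ω p = 0 :=
    fun p hp ω => klAnisoFamily_eq_zero_of_sum_eq_zero β μ K klE0 (d * k - 1) p hp ω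
  have hF'pl : ∀ (ω' : Fin (sectorCount (d * k))) (p : FreqMomentum V M), klAnisoFamily V M β μ K klE0 (d * k) ω' p ≠ 0 →
      ∑ ω, klAnisoFamily V M β μ K klE0 (d * k - 1) ω p = 1 :=
    fun ω' p h => sum_klAnisoFamily_pred_eq_one_of_klAnisoFamily_ne_zero β μ K hdk le_rfl ω' p h
  have hCpl : ∀ X Y, hubbardCovSliceCT V M β μ 0 K (klScale klE0 (d * (k + 1))) (klScale klE0 (d * k)) X Y ≠ 0 →
      ∑ ω, klAnisoFamily V M β μ K klE0 (d * k - 1) ω X.1.1 = 1 ∧ ∑ ω, klAnisoFamily V M β μ K klE0 (d * k - 1) ω Y.1.1 = 1 :=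
    fun X Y h => sum_klAnisoFamily_eq_one_of_blockSliceCT_ne_zero β μ K hdk hJ X Y h
  -- the increment is the born step of the input; read both terms through the plateau
  have h1 : sectorPreimage β (klAnisoFamily V M β μ K klE0 (d * k))
      (effAction ℂ (hubbardCovSliceCT V M β μ 0 K (klScale klE0 (d * (k + 1))) (klScale klE0 (d * k)))
        (ExteriorAlgebra.map (Matrix.toLin' (sectorSubMatrix V M β (bgmFatMultiplier V M klE0 β (nambuXiCT V μ K) (d * k - 1))))
          (klLipInput V M β U μ K d k))) =
      sectorPreimage β (klAnisoFamily V M β μ K klE0 (d * k))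
        (effAction ℂ (hubbardCovSliceCT V M β μ 0 K (klScale klE0 (d * (k + 1))) (klScale klE0 (d * k))) (klTowerInput V M β U μ K d k)) :=
    sectorPreimage_congr_of_map_sectorAnalysis_eq β _
      (by rw [klLipInput_def, map_sectorAnalysis_effAction_map_sectorPreimage_of_plateau hβ _ _ hFF hF0 _ _ _ hCpl hF'pl])
  have h2 : sectorPreimage β (klAnisoFamily V M β μ K klE0 (d * k))
      (ExteriorAlgebra.map (Matrix.toLin' (sectorSubMatrix V M β (bgmFatMultiplier V M klE0 β (nambuXiCT V μ K) (d * k - 1))))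
        (klLipInput V M β U μ K d k)) =
      sectorPreimage β (klAnisoFamily V M β μ K klE0 (d * k)) (klTowerInput V M β U μ K d k) :=
    sectorPreimage_congr_of_map_sectorAnalysis_eq β _
      (by rw [klLipInput_def, map_sectorAnalysis_map_sectorSub_sectorPreimage_of_plateau hβ _ _ hFF hF0 _ hF'pl])
  rw [klLipBorn_def, klTowerIncr_eq_effAction_sub β U μ K d k hZ, sectorPreimage_sub, sectorPreimage_sub, h1, h2]

/-- **THE ONE-VOLUME BLOCK IDENTITY, `(f,g)`-form**: with `f := toLin' S(F̃_{dk−1})`, `g := toLin' (ε • E(F_{dk}))`,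
`klLipBorn V … d k = map g (effAction Γ_k (map f (klLipInput V … d k)) − map f (klLipInput V … d k))` — the left side of the deep block-step door at the input
pair `(V, V + D) := (anything, klLipInput)` reads the born increment of the block. -/
theorem klLipBorn_eq_map_born {β : ℝ} (hβ : β ≠ 0) (U μ : ℝ) (K : TrigPolyC4v) {d k : ℕ} (hdk : 1 ≤ d * k)
    (hZ : hubbardEffPartitionFnCT V M β U μ 0 K (klScale klE0 (d * k)) ≠ 0) :
    klLipBorn V M β U μ K d k =
      ExteriorAlgebra.map (Matrix.toLin' ((((imagTimeWeight β M : ℝ) : ℂ)) • sectorAnalysisMatrix V M β (klAnisoFamily V M β μ K klE0 (d * k))))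
        (effAction ℂ (hubbardCovSliceCT V M β μ 0 K (klScale klE0 (d * (k + 1))) (klScale klE0 (d * k)))
            (ExteriorAlgebra.map (Matrix.toLin' (sectorSubMatrix V M β (bgmFatMultiplier V M klE0 β (nambuXiCT V μ K) (d * k - 1))))
              (klLipInput V M β U μ K d k)) -
          ExteriorAlgebra.map (Matrix.toLin' (sectorSubMatrix V M β (bgmFatMultiplier V M klE0 β (nambuXiCT V μ K) (d * k - 1))))
            (klLipInput V M β U μ K d k)) := by
  rw [klLipBorn_eq_sectorPreimage_born hβ U μ K hdk hZ, sectorPreimage_eq_map_smul_sectorAnalysis]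

end OneVolume

/-! ## §3 Two volumes at the common frame: the born difference = Lipschitz part + source part -/

section TwoVolumes

variable {L b M : ℕ} [NeZero L] [NeZero (b * L)] [NeZero M]

/-- **THE BORN DIFFERENCE SPLITS INTO THE LIPSCHITZ PART AND THE SOURCE PART.**  At the common frame `K`, block `k` with `1 ≤ dk` and the FINE volume's
partition function `Z^K_{bL,Λ_{dk}} ≠ 0`; `f, g, Γ_k` the fine volume's synthesis / scaled analysis / block covariance; `V := klGlue (klLipInput L … d k)` the glued
coarse input (so `V + klLipInputDiff = klLipInput (bL)`):
`klLipBornDiff L b M … d k = [map g (born_{Γ_k}(map f (klLipInput (bL)))) − map g (born_{Γ_k}(map f V))] + [map g (born_{Γ_k}(map f V)) − klGlue (klLipBorn L … d k)]`.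
The first bracket is the left side of `…TwoVolumeLipDeepFirstOrder.sum_pinned_norm_kernel_map_born_sub_born_le_of_deep` at `(V, D) = (klGlue (klLipInput L), klLipInputDiff)`;
the second is the SOURCE (the fine step of the glued coarse input against the glued coarse step). -/
theorem klLipBornDiff_eq_lip_add_src {β : ℝ} (hβ : β ≠ 0) (U μ : ℝ) (K : TrigPolyC4v) {d k : ℕ} (hdk : 1 ≤ d * k)
    (hZ : hubbardEffPartitionFnCT (b * L) M β U μ 0 K (klScale klE0 (d * k)) ≠ 0) :
    klLipBornDiff L b M β U μ K d k =
      ExteriorAlgebra.map (Matrix.toLin' ((((imagTimeWeight β M : ℝ) : ℂ)) •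
          sectorAnalysisMatrix (b * L) M β (klAnisoFamily (b * L) M β μ K klE0 (d * k))))
        ((effAction ℂ (hubbardCovSliceCT (b * L) M β μ 0 K (klScale klE0 (d * (k + 1))) (klScale klE0 (d * k)))
              (ExteriorAlgebra.map (Matrix.toLin' (sectorSubMatrix (b * L) M β (bgmFatMultiplier (b * L) M klE0 β (nambuXiCT (b * L) μ K) (d * k - 1))))
                (klGlue L b M (sectorCount (d * k - 1)) (klLipInput L M β U μ K d k) + klLipInputDiff L b M β U μ K d k)) -
            ExteriorAlgebra.map (Matrix.toLin' (sectorSubMatrix (b * L) M β (bgmFatMultiplier (b * L) M klE0 β (nambuXiCT (b * L) μ K) (d * k - 1))))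
              (klGlue L b M (sectorCount (d * k - 1)) (klLipInput L M β U μ K d k) + klLipInputDiff L b M β U μ K d k)) -
          (effAction ℂ (hubbardCovSliceCT (b * L) M β μ 0 K (klScale klE0 (d * (k + 1))) (klScale klE0 (d * k)))
              (ExteriorAlgebra.map (Matrix.toLin' (sectorSubMatrix (b * L) M β (bgmFatMultiplier (b * L) M klE0 β (nambuXiCT (b * L) μ K) (d * k - 1))))
                (klGlue L b M (sectorCount (d * k - 1)) (klLipInput L M β U μ K d k))) -
            ExteriorAlgebra.map (Matrix.toLin' (sectorSubMatrix (b * L) M β (bgmFatMultiplier (b * L) M klE0 β (nambuXiCT (b * L) μ K) (d * k - 1))))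
              (klGlue L b M (sectorCount (d * k - 1)) (klLipInput L M β U μ K d k)))) +
      (ExteriorAlgebra.map (Matrix.toLin' ((((imagTimeWeight β M : ℝ) : ℂ)) •
          sectorAnalysisMatrix (b * L) M β (klAnisoFamily (b * L) M β μ K klE0 (d * k))))
        (effAction ℂ (hubbardCovSliceCT (b * L) M β μ 0 K (klScale klE0 (d * (k + 1))) (klScale klE0 (d * k)))
              (ExteriorAlgebra.map (Matrix.toLin' (sectorSubMatrix (b * L) M β (bgmFatMultiplier (b * L) M klE0 β (nambuXiCT (b * L) μ K) (d * k - 1))))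
                (klGlue L b M (sectorCount (d * k - 1)) (klLipInput L M β U μ K d k))) -
            ExteriorAlgebra.map (Matrix.toLin' (sectorSubMatrix (b * L) M β (bgmFatMultiplier (b * L) M klE0 β (nambuXiCT (b * L) μ K) (d * k - 1))))
              (klGlue L b M (sectorCount (d * k - 1)) (klLipInput L M β U μ K d k))) -
        klGlue L b M (sectorCount (d * k)) (klLipBorn L M β U μ K d k)) := by
  rw [klLipBornDiff_def, klLipBorn_eq_map_born hβ U μ K hdk hZ, klLipInput_fine_eq (L := L) (b := b) β U μ K d k]
  simp only [map_sub, map_add]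
  abel

end TwoVolumes

end Summit.HubbardSuperconductivity.HubbardSuperconductivity.Theorems.TwoVolumeLip

end
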